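import Summits.ABC.IUTFork.Joshi.FrobenioidsJoshiGlobal

/-!
# Non-vacuity witnesses, part 1: the §10 interface structures of `Joshi/FrobenioidsJoshiGlobal.lean`
# (ATS III, arXiv 2401.13508v4 — `ElementaryFrobenioid`, `DegreeFrobenioid`, `VarietyDivisorDatum`)

Proof-only companion (abc-iut cell, branch E, seat abc-iut-E-t34, slot T-34a; E-plan-2 RULING 08:35Z (4): "authors
first for NV witnesses of their own interface structures"; rung LADDER-ABC:A2.E). TAKES NO SIDE on [IUTchIII] Cor.
3.12 or on any author; typed ≠ proved. PURPOSE: every `structure` the typing file introduces is INHABITED (so no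
statement over them quantifies over an empty type). `ElementaryFrobenioid` / `DegreeFrobenioid` are inhabited by the
honest object `Frob(ℚ_p, |−|_p)` through the bridge `Frob.toModel` on seat E-t32's carriers; `VarietyDivisorDatum` by
labelled TOY data. Part 2 (`Joshi/TemperedFrobenioidsJoshiWitness.lean`) does the same for `TemperedDivisorSystem`,
`TemperedCoverings`, `Fragment3Dictionary` and shows their claim-`Prop`s are genuine conditions. Nothing here models
Joshi's actual curves / coverings / holomorphoids. [claim: Joshi2024ATS3, status: disputed]
-/

noncomputable section

namespace Summit.ABC.IUTFork.Joshi.ATS3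

/-! ## 1. `ElementaryFrobenioid`, `DegreeFrobenioid` — inhabited by `Frob(ℚ_2, |−|_2)` (honest instance) -/

/-- `Frob(ℚ_p, |−|_{ℚ_p})` with its arithmetic degree is a `DegreeFrobenioid` (bridge `Frob.toModel` on E-t32's
`Frob.normAbs ℚ_[p]`): the type is inhabited by an honest object of §10.2. [folklore] -/
theorem nonempty_degreeFrobenioid : Nonempty DegreeFrobenioid.{0} := ⟨Frob.toModel (Frob.normAbs ℚ_[2])⟩

/-- … hence so is `ElementaryFrobenioid`. [folklore] -/
theorem nonempty_elementaryFrobenioid : Nonempty ElementaryFrobenioid.{0} :=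
  ⟨(Frob.toModel (Frob.normAbs ℚ_[2])).toElementaryFrobenioid⟩

/-- The claim-shaped `Prop` `ElementaryFrobenioid.IsIso` is satisfiable (reflexivity). [folklore] -/
theorem exists_isIso : ∃ F G : ElementaryFrobenioid.{0}, F.IsIso G :=
  ⟨_, _, ElementaryFrobenioid.IsIso.refl (Frob.toModel (Frob.normAbs ℚ_[2])).toElementaryFrobenioid⟩

/-! ## 2. `VarietyDivisorDatum` — a TOY inhabitant (divisor group `ℤ`, effective cone `ℤ_{≥0}`, `E(X)^* := ℤ^×`) -/

/-- `VarietyDivisorDatum` is inhabited (TOY: `Div = ℤ` "degrees", `Div⁺ = ℤ_{≥0}`, functions `ℤ^× = {±1}` with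
trivial divisor — think of a curve with one closed point and only constant units; NOT a model of print's `X/E`).
[folklore] -/
theorem nonempty_varietyDivisorDatum : Nonempty VarietyDivisorDatum.{0} :=
  ⟨{ Div := ℤ, eff := AddSubmonoid.nonneg ℤ, FnUnits := ℤˣ, divisor := 1 }⟩

end Summit.ABC.IUTFork.Joshi.ATS3

end
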